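import Summits.QuantumAdvantage.QuantumAdvantage.Theorems.SosSandwichTransferPBWalkMachineDefs
import Summits.QuantumAdvantage.QuantumAdvantage.Theorems.SosSandwichTransferPBTranscriptCongr
import HarnessLib

/-!
# Crux `TransferPB` (stmt-QuantumAdvantage-15238, route SosSandwich), line `birth` — the reference transcript machine is CORRECT

For the reference machine `walkMachine Wf Df` of `Theorems/SosSandwichTransferPBWalkMachineDefs.lean`:

* `eval_filterComp`, `eval_flatMapComp`, `eval_askG`, `eval_askA` — evaluation laws;
* `eval_liveComp`, `eval_candsComp`, `eval_walkComp`, `length_filter_eval_meansComp`, `eval_machineComp` — under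
  an oracle answering `true :: v` by `g v` and `false :: u` by `inA u`, the computations evaluate to `liveLevel`,
  `descentCands`, `strWalk`, `meanCount` and the threshold bit of the string-level specification;
* `decodeBool_combined_true`, `decodeBool_combined_false` — the combined oracle `A ⊕ g` is such an oracle
  (`inA = 𝟙_A`);
* **`run_walkMachine`** — for EVERY input `x`, answer function `g`, oracle `A`, width bound and budget, with fuel
  exceeding the query count, `(walkMachine Wf Df)^{A ⊕ g}(x) = [20 ≤ meanCount g x (strWalk g x (Wf x) 𝟙_A (Df x) [])]`
  — exactly the run clause of (M_str) (`stub_pbOracleSimulation_of_stringMachines`,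
  `Theorems/SosSandwichTransferPBDescentWalk.lean`). So (M_str) is realisable as a transcript machine; its
  remaining content is polynomial TIME (an `IsPolyTime` machine with the same runs, `Wf ≥ oracleWidth`,
  `Df ≥ machineBudget` computed from `1ⁿ` by the uniformity of `F`) and the polynomial round / query-length
  budget (`Theorems/SosSandwichTransferPBDescentBound.lean`).

All proved; no named fact. Sources: S. Aaronson, A. Ambainis, Theory Comput. 10 (2014), proof of Thm. 23 (p. 14);
S. Arora, B. Barak, Computational Complexity (CUP 2009), §3.4 (the run is a function of the answers).
-/

-- D-0017: single-conjunct summit ⇒ the duplicate `QuantumAdvantage.QuantumAdvantage` is mandated.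
set_option linter.dupNamespace false

noncomputable section

namespace Summit.QuantumAdvantage.QuantumAdvantage.Cruxes.TransferPB.Birth

open Finset Literature.Computability.Cryptography Literature.Computability.Complexity
  Literature.Computability.QuantumComplexity Literature.Computability.QuantumComplexity.ClassicalSimulation

namespace SimTreePB


section Eval

variable {α β : Type} (O : Oracle)

/-- `eval` of `filterComp` is `List.filter`. [folklore] -/
@[simp] theorem eval_filterComp (p : α → OracleComp Bool) (l : List α) :
    OracleComp.eval O (filterComp p l) = l.filter fun a => OracleComp.eval O (p a) := by
  induction l with
  | nil => rfl
  | cons a l ih =>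
    simp only [filterComp, OracleComp.eval_bind, OracleComp.eval_pure, ih, List.filter_cons]

/-- `eval` of `flatMapComp` is `List.flatMap`. [folklore] -/
@[simp] theorem eval_flatMapComp (f : α → OracleComp (List β)) (l : List α) :
    OracleComp.eval O (flatMapComp f l) = l.flatMap fun a => OracleComp.eval O (f a) := by
  induction l with
  | nil => rfl
  | cons a l ih => simp [flatMapComp, ih]

end Eval

section Correct

variable {x : List Bool} {g : List Bool → Bool} {inA : List Bool → Bool} {O : Oracle}

/-- `askG` returns `g`'s answer under an oracle answering `true :: v` by `g v`. [folklore] -/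
theorem eval_askG (hO : ∀ v : List Bool, Computability.decodeBool (O (true :: v)) = g v) (v : List Bool) :
    OracleComp.eval O (askG v) = g v := by
  simp [askG, hO]

/-- `askA` returns the bit of `A` under an oracle answering `false :: u` by `inA u`. [folklore] -/
theorem eval_askA (hA : ∀ u : List Bool, Computability.decodeBool (O (false :: u)) = inA u) (u : List Bool) :
    OracleComp.eval O (askA u) = inA u := by
  simp [askA, hA]

/-- **`liveComp` computes `liveLevel`.** [folklore] -/
theorem eval_liveComp (hO : ∀ v : List Bool, Computability.decodeBool (O (true :: v)) = g v)
    (π : List (List Bool × Bool)) :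
    ∀ j : ℕ, OracleComp.eval O (liveComp x π j) = liveLevel (fun u => g (encBlockS x π u)) j
  | 0 => by
    simp only [liveComp, OracleComp.eval_bind, OracleComp.eval_pure, eval_askG hO]
    rfl
  | j + 1 => by
    simp only [liveComp, OracleComp.eval_bind, eval_liveComp hO π j, eval_flatMapComp, eval_filterComp, eval_askG hO,
      liveLevel, Bool.decide_eq_true]

/-- **`candsComp` computes `descentCands`.** [folklore] -/
theorem eval_candsComp (hO : ∀ v : List Bool, Computability.decodeBool (O (true :: v)) = g v)
    (π : List (List Bool × Bool)) (W : ℕ) :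
    OracleComp.eval O (candsComp x π W) =
      descentCands (fun u => g (encBlockS x π u)) (fun u => g (encSingleS x π u)) W (π.map Prod.fst) := by
  simp only [candsComp, OracleComp.eval_bind, eval_flatMapComp, eval_liveComp hO, eval_filterComp, OracleComp.eval_pure,
    eval_askG hO]
  unfold descentCands
  congr 1
  funext u
  by_cases h1 : g (encSingleS x π u) = true <;> by_cases h2 : u ∈ π.map Prod.fst <;> simp [h1, h2]

/-- **`walkComp` computes `strWalk`.** [folklore] -/
theorem eval_walkComp (hO : ∀ v : List Bool, Computability.decodeBool (O (true :: v)) = g v)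
    (hA : ∀ u : List Bool, Computability.decodeBool (O (false :: u)) = inA u) (W : ℕ) :
    ∀ (D : ℕ) (π : List (List Bool × Bool)), OracleComp.eval O (walkComp x W D π) = strWalk g x W inA D π
  | 0, π => rfl
  | D + 1, π => by
    simp only [walkComp, OracleComp.eval_bind, eval_candsComp hO]
    unfold strWalk descentPick
    cases (descentCands (fun u => g (encBlockS x π u)) (fun u => g (encSingleS x π u)) W (π.map Prod.fst)).argmin strNum with
    | none => rfl
    | some u => simp only [OracleComp.eval_bind, eval_askA hA, eval_walkComp hO hA W D]

/-- **`meansComp` followed by counting gives `meanCount`.** [folklore] -/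
theorem length_filter_eval_meansComp (hO : ∀ v : List Bool, Computability.decodeBool (O (true :: v)) = g v)
    (π : List (List Bool × Bool)) :
    ((OracleComp.eval O (meansComp x π)).filter fun b => b = true).length = meanCount g x π := by
  simp only [meansComp, OracleComp.eval_forEach, eval_askG hO]
  unfold meanCount
  rw [List.filter_map, List.length_map]
  have hnd : ((Icc 1 40).toList.filter ((fun b : Bool => decide (b = true)) ∘ fun j => g (encMeanS x π j))).Nodup :=
    (Finset.nodup_toList _).filter _
  rw [← List.toFinset_card_of_nodup hnd]
  congr 1
  ext j
  simp [Finset.mem_filter]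

/-- **The reference machine's computation evaluates to the string-walk threshold bit.** [folklore] -/
theorem eval_machineComp (hO : ∀ v : List Bool, Computability.decodeBool (O (true :: v)) = g v)
    (hA : ∀ u : List Bool, Computability.decodeBool (O (false :: u)) = inA u) (Wf Df : List Bool → ℕ) :
    OracleComp.eval O (machineComp Wf Df x) =
      decide (20 ≤ meanCount g x (strWalk g x (Wf x) inA (Df x) [])) := by
  simp only [machineComp, OracleComp.eval_bind, OracleComp.eval_pure, eval_walkComp hO hA,
    length_filter_eval_meansComp hO]

/-- The combined oracle `A ⊕ g` answers `true :: v` by `g v` (decoded bit). [folklore] -/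
theorem decodeBool_combined_true (A : Set (List Bool)) (g : List Bool → Bool) (v : List Bool) :
    Computability.decodeBool (Oracle.ofLanguage {w : List Bool | ∃ v : List Bool,
        (w = false :: v ∧ v ∈ A) ∨ (w = true :: v ∧ g v = true)} (true :: v)) = g v := by
  rw [Oracle.ofLanguage_apply, Computability.decode_encodeBool]
  rcases Bool.eq_false_or_eq_true (g v) with h | h
  · rw [h]; exact (Set.mem_iff_boolIndicator _ _).1 ((mem_combined_true_cons A g v).2 h)
  · rw [h]
    refine (Set.notMem_iff_boolIndicator _ _).1 fun hm => ?_
    have := (mem_combined_true_cons A g v).1 hm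
    rw [h] at this
    exact Bool.false_ne_true this

/-- The combined oracle `A ⊕ g` answers `false :: u` by the indicator of `A` (decoded bit). [folklore] -/
theorem decodeBool_combined_false (A : Set (List Bool)) (g : List Bool → Bool) (u : List Bool) :
    Computability.decodeBool (Oracle.ofLanguage {w : List Bool | ∃ v : List Bool,
        (w = false :: v ∧ v ∈ A) ∨ (w = true :: v ∧ g v = true)} (false :: u)) = A.boolIndicator u := by
  rw [Oracle.ofLanguage_apply, Computability.decode_encodeBool]
  by_cases h : u ∈ A
  · rw [(Set.mem_iff_boolIndicator A u).1 h]
    exact (Set.mem_iff_boolIndicator _ _).1 ((mem_combined_false_cons A g u).2 h)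
  · rw [(Set.notMem_iff_boolIndicator A u).1 h]
    exact (Set.notMem_iff_boolIndicator _ _).1 fun hm => h ((mem_combined_false_cons A g u).1 hm)

/-- **The reference transcript machine is CORRECT** (for EVERY answer function `g`, oracle `A`, width bound and
budget): with fuel exceeding its query count, its run with the combined oracle `A ⊕ g` on `x` outputs the
string-walk threshold bit `[20 ≤ meanCount g x (strWalk g x (Wf x) 𝟙_A (Df x) [])]` — the run clause of (M_str)
(`stub_pbOracleSimulation_of_stringMachines`). What (M_str) asks beyond this is polynomial TIME of a machine
with these runs. [cite: AaronsonAmbainis2014, Thm. 23 (proof, p. 14)] -/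
theorem run_walkMachine (Wf Df : List Bool → ℕ) (x : List Bool) (g : List Bool → Bool) (A : Set (List Bool))
    {n : ℕ} (hn : OracleComp.queryCount (Oracle.ofLanguage {w : List Bool | ∃ v : List Bool,
        (w = false :: v ∧ v ∈ A) ∨ (w = true :: v ∧ g v = true)}) (machineComp Wf Df x) < n) :
    (walkMachine Wf Df).run (Oracle.ofLanguage {w : List Bool | ∃ v : List Bool,
        (w = false :: v ∧ v ∈ A) ∨ (w = true :: v ∧ g v = true)}) n x =
      some (decide (20 ≤ meanCount g x (strWalk g x (Wf x) (fun u => A.boolIndicator u) (Df x) []))) := by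
  unfold walkMachine
  rw [OracleComp.run_toOracleAlg _ _ _ hn,
    eval_machineComp (decodeBool_combined_true A g) (decodeBool_combined_false A g)]

end Correct

end SimTreePB

end Summit.QuantumAdvantage.QuantumAdvantage.Cruxes.TransferPB.Birth

end
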